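import Literature.Computability.QuantumComplexity.QAOAThreeRegular
import Literature.Combinatorics.SimpleGraph.TriangleFreeLocalCut
import Literature.Combinatorics.SimpleGraph.TriangleFreeLocalCutOptimal
import HarnessLib

/-!
# One-round classical local algorithms versus the level-1 QAOA on triangle-free regular MaxCut (Hastings 2019, §3)

Topic `Literature/Computability/QuantumComplexity` (pub-qadeq lane); sequel of `QAOAThreeRegular.lean`
(WHJR Corollary 1: on a triangle-free `(d+1)`-regular graph the optimal level-1 QAOA value is `M₁ =
|E| · ½(1 + regularMax d)`, `regularMax d = (1/√(d+1))(d/(d+1))^{d/2}`, i.e. improvement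
`(1/(2√D))(1 − 1/D)^{(D−1)/2} ≥ 0.3032/√D` over random, `D = d + 1`) and of
`Literature/Combinatorics/SimpleGraph/TriangleFreeLocalCut.lean` (Hirvonen–Rybicki–Schmid–Suomela's
one-round threshold algorithm `𝒜_τ`, its exact performance `α(τ, D)`, and Hastings' formula `½ +
¼(A_q² − B_q²)` for spin-symmetric randomised one-round rules). It PROVES, instance by instance, the
comparison of Hastings 2019, §3: “It was claimed [Ryan-Anderson 2018] that this value ‘improves upon
the currently known best classical approximation algorithm for these graphs’. We show that this is not
true … a local classical algorithm beats this QAOA … for all choices of `3 ≤ D ≤ 1000` … this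
threshold algorithm outperforms the QAOA with the exceptions of `D = 3, 4, 6, 11` for which the QAOA
is better (for `D = 2`, both the algorithms have the same performance) … For `D = 6, 11` we prove
that a local classical algorithm outperforms the QAOA” — as exact inequalities between `M₁(G)` and the
expected number of cut edges of the classical rule on EVERY triangle-free `D`-regular graph `G`, for
the degrees of the paper's table (`D ≤ 19`).

HONEST FRAMING: instance-level adjudication of specific advantage claims; no claim about BQP vs BPP
or the summit. The statements compare the EXPECTED cut of a one-round classical rule (one random
symbol — plus, for the soft rules, one private uniform symbol — per vertex, one communication round)
with the OPTIMUM over angles of the level-1 QAOA expectation `M₁`; nothing is said about QAOA at `p ≥ 2`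
(Marwaha 2021 / Barak–Marwaha 2022 are not formalised), about sampling, or about any device. For
`D = 3, 4` Hastings' headline classical win uses CONTINUOUS initial values (§3.2, Monte-Carlo evaluated,
not formalised); what is proved here is his exactly-enumerable DISCRETE variant (§3.3, initial values
uniform on `{−1,−1/3,1/3,1}`, `c = 0.599`), which also beats QAOA₁ at `D = 3` and `D = 4`, together
with the converse printed statement that QAOA₁ beats every THRESHOLD rule at `D = 3, 4, 6, 11` (HRSS's
max-SAT optimality of `𝒜_3` among the one-round rules of THEIR model — one random BIT per node — at
`d = 3` is not formalised).

## Sources (held texts, read at the cited places)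

* [Hastings2019BoundedDepth] M. B. Hastings, *Classical and Quantum Bounded Depth Approximation
  Algorithms*, Quantum Inf. Comput. 19 (2019) 1116 = arXiv:1905.07047 (`lit read arxiv:1905.07047`,
  tex chunks p0009–p0011, p0017). §3: “The optimal value of the parameters of the single step QAOA can
  be computed analytically, giving an expected fraction of edges cut … equal to `½ + (1/(2√D))(1 −
  1/D)^{(D−1)/2} ≥ ½ + 0.3032/√D`”, “we will say that an algorithm improves by a factor `δ` over random
  if the expected fraction of cut edges is at least `½ + δ`”, “we find that for all choices of `3 ≤ D ≤
  1000` that this threshold algorithm outperforms the QAOA with the exceptions of `D = 3,4,6,11` for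
  which the QAOA is better (for `D = 2`, both the algorithms have the same performance). In appendix
  [7] we give some numerical results for `D` up to `19`.” §3.1 (`D = 6, 11`): “For `D = 11` … If at
  most `6` neighbors agree, then the spin does not flip. If more than `8` neighbors agree, then the spin
  does flip. If `7` neighbors agree, then the spin flips with a probability chosen so that its
  expectation value is equal to `−0.1` times its initial value (i.e., it flips with a probability
  `0.55`). This led to an improvement over random by `0.09868…`, which is larger than the value `0.0936`
  for the QAOA … For `D = 6` … If at most `4` neighbors agree the spin does not flip, if `5` or more
  neighbors agree the spin does flip, and if `4` neighbors agree then the spin flips with probability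
  `0.65`. This led to an improvement by a factor `0.13018…`, again larger than the value `0.1294` for
  the QAOA.” §3.3: the formula `¼[(Σ_n 2^{−(D−1)} C(D−1,n) q(n))² − (Σ_n 2^{−(D−1)} C(D−1,n) q(n+1))²]`
  (formalised in `TriangleFreeLocalCut.lean`). §7 (Appendix “Numerical Results for Triangle Free
  MAX-CUT”): “The performance numbers for the QAOA are obtained from the exact formula” (the table
  itself is not in the held tex text; the threshold values used below are recomputed optimal
  thresholds and every comparison is re-derived exactly, not copied).
* [HirvonenRybickiSchmidSuomela2017] (for `𝒜_τ`, `α(τ,d)`, Lemma 2) and [WangHadfieldJiangRieffel2018]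
  §3 Cor. 1 (for `M₁`) — see the two imported files.

## What is formalised (all proved, 0 named facts)

* `profA`, `profB`: Hastings' sums `2^{D−1} s A_q`, `2^{D−1} s B_q` as INTEGERS for a rational profile
  `q = qZ/s`; **`expCutCount_eq_of_profile`**: on a `D`-regular triangle-free graph a spin-symmetric
  one-round rule with profile `qZ/s` cuts `|E| · (½ + (a² − b²)/(4 s² 4^{D−1}))` edges in expectation
  (`a = profA`, `b = profB`; HRSS Lemma 2 + Hastings' formula).
* The three integer criteria against `M₁ = |E| · ½(1 + regularMax d)` on triangle-free
  `(d+1)`-regular graphs with an edge: **`maxLevel_one_lt_expCutCount_of_profile`** (the rule beats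
  QAOA₁ if `b² < a²` and `4 s⁴ 16^d d^d < (a²−b²)² (d+1)^{d+1}`),
  **`expCutCount_lt_maxLevel_one_of_profile`** (QAOA₁ beats the rule if `a² ≤ b²` or the reverse strict
  inequality), **`expCutCount_eq_maxLevel_one_of_profile`** (tie on equality) — by comparing
  `regularMax d` with `(a² − b²)/(2 s² 4^d)` through their squares (`regularMax d)² = d^d/(d+1)^{d+1}`).
* **`maxLevel_one_lt_expCutCount_threshold`**: for `(D, τ) = (5,4), (7,5), (8,6), (9,6), (10,7),
  (12,8), (13,9), (14,9), (15,10), (16,10), (17,11), (18,11), (19,12)` the threshold rule `𝒜_τ` BEATS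
  QAOA₁ on every triangle-free `D`-regular graph (`M₁(G) < 𝔼[#cut edges of 𝒜_τ(G)] = α(τ,D)·|E|`),
  each by a kernel-checked integer inequality (`decide`).
* **`expCutCount_threshold_lt_maxLevel_one`**: for `D = 3, 4, 6, 11` and EVERY `τ`, QAOA₁ beats
  `𝒜_τ` (`τ ≤ D + 1` case by case, larger `τ` output the uniform random cut, `profA_thrZ_eq_profB`).
* **`expCutCount_threshold_two_eq_maxLevel_one`**: `D = 2`, a tie at `¾|E|`.
* Hastings' soft thresholds as one-round rules with a private uniform symbol in `Fin 20`:
  `softRule11` (flip probability `0.55 = 11/20` at `7` agreeing neighbours; profile `softQ11/10`,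
  `softRule11_symmetric`), **`expCutCount_softRule11`** (`= |E| · (½ + 413919/4194304)`,
  `413919/4194304 = 0.0986859…`, the printed `0.09868…`) and **`maxLevel_one_lt_expCutCount_softRule11`**
  (beats QAOA₁ on every triangle-free `11`-regular graph); `softRule6` / `softQ6` /
  `softRule6_symmetric`, **`expCutCount_softRule6`** (`= |E| · (½ + 2133/16384)`, `2133/16384 =
  0.13018798828125`, the printed `0.13018…`) and **`maxLevel_one_lt_expCutCount_softRule6`** (beats
  QAOA₁ on every triangle-free `6`-regular graph). SCOPE CAVEAT recorded at `softRule6`: the printed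
  sentence for `D = 6` is inconsistent as printed (“at most 4 … does not flip … if 4 … flips with
  probability 0.65”); its literal reading `q(4) = −0.3` yields `0.12286… < 0.1294` and would NOT beat
  QAOA₁, whereas the printed value `0.13018…` is reproduced EXACTLY by `q(4) = +0.3` (flip with
  probability `0.35`, keep with probability `0.65`), which is the rule formalised here.

* Hastings' DISCRETE local tensor rule (§3.2–§3.3): `tensorW` (the values `{−1,−1/3,1/3,1}` scaled to
  `{−3,−1,1,3}`), `tensorF` (`Z_i = sign(1000·(3v_i) − 599·Σ_j (3v_j))`, i.e. `c = 0.599`, exact integer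
  arithmetic), kernel evaluations `pairSumZ_tensor_three = −1600`, `pairSumZ_tensor_four = −21768`,
  **`vexpCutCount_tensor_three`** (`= |E| · 89/128 = 0.6953125 |E|`) and **`vexpCutCount_tensor_four`**
  (`= |E| · 10913/16384 = 0.66607… |E|`), the integer criterion `maxLevel_one_lt_vexpCutCount_of_int`,
  and **`maxLevel_one_lt_vexpCutCount_tensor_three` / `_four`** (the rule beats QAOA₁ on every
  triangle-free `3`- resp. `4`-regular graph: `0.69531 > 0.69245`, `0.66608 > 0.66238`).
* **`expCutCount_rule_lt_maxLevel_one_three` / `_four`** (two-sided form at `D = 3, 4`, with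
  `TriangleFreeLocalCutOptimal`: HRSS §2.5 optimality of the threshold rule in their model): QAOA₁
  beats EVERY deterministic one-round rule `𝒜 : V_𝒩 → {a,b}` on every triangle-free `3`- or
  `4`-regular graph with an edge.
* larger degrees by falling-factorial binomials (`chooseFast`, `profAFast`, `profBFast`,
  `profA_eq_fast`, `profB_eq_fast`): **`maxLevel_one_lt_expCutCount_threshold_large`** (`𝒜_τ` beats
  QAOA₁ on every triangle-free `D`-regular graph for every `20 ≤ D ≤ 100`, `81` kernel-checked
  integer inequalities) and **`hastings_local_beats_qaoa_one_le_hundred`** (the headline below for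
  every `3 ≤ D ≤ 100`).
* **`hastings_local_beats_qaoa_one`**: for EVERY `3 ≤ D ≤ 19` and every triangle-free `D`-regular graph
  with an edge, one of the one-round classical rules above (threshold ∕ soft threshold ∕ discrete tensor
  rule) has expected cut strictly larger than `M₁` — the paper's §3 claim over the range of its table.

NOT formalised: the CONTINUOUS local tensor algorithm of §3.2 (uniform on `[−1,1]`, `c = 0.6` ∕ `0.54`,
Monte Carlo `0.1980` ∕ `0.1693`); degrees `D ≥ 101` (“up to `D = 1000`” and the scaling argument of
§3.4); MAX-3-LIN-2 (§2) and the §5 no-go for bounded-depth QAOA.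
-/

noncomputable section

open Finset Literature.Combinatorics.SimpleGraph.TriangleFreeLocalCut

namespace Literature.Computability.QuantumComplexity

namespace QAOA

variable {V : Type*} [Fintype V] [DecidableEq V] (G : SimpleGraph V) [DecidableRel G.Adj]

/-! ## The improvement over random of a spin-symmetric one-round rule with a rational profile -/

/-- Hastings' `2^{D−1} s A_q` as an integer, for a profile `q = qZ/s`. [cite: Hastings2019BoundedDepth,
§3.3 (second display, “Σ_n 2^{−(D−1)} C(D−1,n) q(n)”)] -/
def profA (D : ℕ) (qZ : ℕ → ℤ) : ℤ := ∑ n ∈ range D, ((D - 1).choose n : ℤ) * qZ n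

/-- Hastings' `2^{D−1} s B_q` as an integer, for a profile `q = qZ/s`. [cite: Hastings2019BoundedDepth,
§3.3 (first display, “Σ_n 2^{−(D−1)} C(D−1,n) q(n+1)”)] -/
def profB (D : ℕ) (qZ : ℕ → ℤ) : ℤ := ∑ n ∈ range D, ((D - 1).choose n : ℤ) * qZ (n + 1)

/-- `A_q = profA/(s 2^{D−1})`. [cite: Hastings2019BoundedDepth, §3.3] -/
private theorem hastingsA_eq_profA (D s : ℕ) (qZ : ℕ → ℤ) :
    hastingsA D (fun n => (qZ n : ℝ) / s) = (profA D qZ : ℝ) / (s * 2 ^ (D - 1)) := by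
  unfold hastingsA profA
  push_cast
  simp_rw [← mul_div_assoc]
  rw [← sum_div, div_div]

/-- `B_q = profB/(s 2^{D−1})`. [cite: Hastings2019BoundedDepth, §3.3] -/
private theorem hastingsB_eq_profB (D s : ℕ) (qZ : ℕ → ℤ) :
    hastingsB D (fun n => (qZ n : ℝ) / s) = (profB D qZ : ℝ) / (s * 2 ^ (D - 1)) := by
  unfold hastingsB profB
  push_cast
  simp_rw [← mul_div_assoc]
  rw [← sum_div, div_div]

/-- **The expected number of cut edges of a spin-symmetric one-round rule with rational profile
`q = qZ/s` on a `D`-regular triangle-free graph is `|E| · (½ + (a² − b²)/(4 s² 4^{D−1}))`** with the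
integers `a = profA`, `b = profB` (HRSS Lemma 2 + Hastings' formula). [cite: Hastings2019BoundedDepth,
§3.3 (third display)] [cite: HirvonenRybickiSchmidSuomela2017, §2.4 Lemma 2] -/
theorem expCutCount_eq_of_profile {R : Type*} [Fintype R] [DecidableEq R] [Nonempty R] {D s : ℕ}
    (hD : 1 ≤ D) (hs : 0 < s) {A : Rule R} {qZ : ℕ → ℤ}
    (hA : IsSymmetric A (fun n => (qZ n : ℝ) / s) D) (hreg : G.IsRegularOfDegree D)
    (hG : G.CliqueFree 3) :
    expCutCount G A = #G.edgeFinset *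
      (1 / 2 + ((profA D qZ : ℝ) ^ 2 - (profB D qZ : ℝ) ^ 2) / (4 * s ^ 2 * 4 ^ (D - 1))) := by
  rw [expCutCount_eq G hreg hG A, ngraphWeight_eq_of_symmetric hD hA, hastingsA_eq_profA,
    hastingsB_eq_profB]
  have hs' : (s : ℝ) ≠ 0 := by exact_mod_cast hs.ne'
  have h4 : (4 : ℝ) ^ (D - 1) = (2 ^ (D - 1)) ^ 2 := by
    rw [← pow_mul, mul_comm, pow_mul]; norm_num
  rw [h4]
  congr 1
  field_simp

/-- `(regularMax d)² = d^d/(d+1)^{d+1}` (restated from `QAOALevelOneMaxCut`, where it is private).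
[cite: WangHadfieldJiangRieffel2018, §3 Cor. 1 (F* = |E|/2 (1 + (1/√(d+1))(d/(d+1))^{d/2}))] -/
private theorem regularMax_sq' (d : ℕ) : regularMax d ^ 2 = (d : ℝ) ^ d / (d + 1) ^ (d + 1) := by
  unfold regularMax
  rw [mul_pow, ← pow_mul, mul_comm d 2, pow_mul, Real.sq_sqrt (by positivity), div_pow,
    Real.sq_sqrt (by positivity), div_pow, one_pow, pow_succ]
  field_simp

/-- `regularMax d ≥ 0`. [folklore] -/
private theorem regularMax_nonneg' (d : ℕ) : 0 ≤ regularMax d := by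
  unfold regularMax; positivity

/-- `regularMax d > 0` for `d ≥ 1`. [folklore] -/
private theorem regularMax_pos' {d : ℕ} (hd : 0 < d) : 0 < regularMax d := by
  unfold regularMax
  have : (0 : ℝ) < d := by exact_mod_cast hd
  positivity

/-- `(4^d)² = 16^d`. [folklore] -/
private theorem four_pow_sq (d : ℕ) : ((4 : ℝ) ^ d) ^ 2 = 16 ^ d := by
  rw [← pow_mul, mul_comm, pow_mul]; norm_num

/-- **Integer criterion: the rule BEATS QAOA₁.** If `b² < a²` and `4 s⁴ 16^d d^d < (a² − b²)² (d+1)^{d+1}`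
then on every triangle-free `(d+1)`-regular graph with an edge the rule's expected number of cut edges
exceeds `M₁ = max_{γ,β} F₁(γ,β)` (WHJR Cor. 1: `M₁ = |E| · ½(1 + regularMax d)`). [cite:
Hastings2019BoundedDepth, §3 (“we will show that a local classical algorithm beats this QAOA”)] [cite:
WangHadfieldJiangRieffel2018, §3 Cor. 1] -/
theorem maxLevel_one_lt_expCutCount_of_profile {R : Type*} [Fintype R] [DecidableEq R] [Nonempty R]
    {d s : ℕ} (hd : 0 < d) (hs : 0 < s) {A : Rule R} {qZ : ℕ → ℤ}
    (hA : IsSymmetric A (fun n => (qZ n : ℝ) / s) (d + 1))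
    (hb : profB (d + 1) qZ ^ 2 < profA (d + 1) qZ ^ 2)
    (h : 4 * (s : ℤ) ^ 4 * 16 ^ d * (d : ℤ) ^ d
      < (profA (d + 1) qZ ^ 2 - profB (d + 1) qZ ^ 2) ^ 2 * ((d : ℤ) + 1) ^ (d + 1))
    (hreg : G.IsRegularOfDegree (d + 1)) (hG : G.CliqueFree 3) (hE : G.edgeFinset.Nonempty) :
    maxLevel G 1 < expCutCount G A := by
  rw [maxLevel_one_eq_of_regular_cliqueFree G hd hreg hG,
    expCutCount_eq_of_profile G (by omega) hs hA hreg hG, Nat.add_sub_cancel]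
  have hEpos : (0 : ℝ) < #G.edgeFinset := by exact_mod_cast card_pos.2 hE
  apply mul_lt_mul_of_pos_left _ hEpos
  have hs' : (0 : ℝ) < s := by exact_mod_cast hs
  have hb' : (profB (d + 1) qZ : ℝ) ^ 2 < (profA (d + 1) qZ : ℝ) ^ 2 := by exact_mod_cast hb
  have h' : 4 * (s : ℝ) ^ 4 * 16 ^ d * (d : ℝ) ^ d
      < ((profA (d + 1) qZ : ℝ) ^ 2 - (profB (d + 1) qZ : ℝ) ^ 2) ^ 2 * ((d : ℝ) + 1) ^ (d + 1) := by
    exact_mod_cast h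
  set a : ℝ := (profA (d + 1) qZ : ℝ)
  set b : ℝ := (profB (d + 1) qZ : ℝ)
  have hab : 0 < a ^ 2 - b ^ 2 := by linarith
  -- regularMax d < x := (a² − b²)/(2 s² 4^d), by comparing squares
  set x : ℝ := (a ^ 2 - b ^ 2) / (2 * s ^ 2 * 4 ^ d) with hx
  have hx0 : 0 < x := by positivity
  have hsq : regularMax d ^ 2 < x ^ 2 := by
    rw [regularMax_sq', hx, div_pow, div_lt_div_iff₀ (by positivity) (by positivity)]
    calc (d : ℝ) ^ d * (2 * (s : ℝ) ^ 2 * 4 ^ d) ^ 2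
        = 4 * (s : ℝ) ^ 4 * 16 ^ d * (d : ℝ) ^ d := by rw [← four_pow_sq]; ring
      _ < (a ^ 2 - b ^ 2) ^ 2 * ((d : ℝ) + 1) ^ (d + 1) := h'
  have hlt : regularMax d < x := (pow_lt_pow_iff_left₀ (regularMax_nonneg' d) hx0.le two_ne_zero).1 hsq
  have hrew : 1 / 2 + (a ^ 2 - b ^ 2) / (4 * (s : ℝ) ^ 2 * 4 ^ d) = 1 / 2 * (1 + x) := by
    rw [hx]; field_simp; ring
  rw [hrew]
  linarith

/-- **Integer criterion: QAOA₁ BEATS the rule.** If `a² ≤ b²`, or `(a² − b²)² (d+1)^{d+1} < 4 s⁴ 16^d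
d^d`, then on every triangle-free `(d+1)`-regular graph with an edge, `M₁` exceeds the rule's expected
number of cut edges. [cite: Hastings2019BoundedDepth, §3 (“with the exceptions of D = 3,4,6,11 for which
the QAOA is better”)] [cite: WangHadfieldJiangRieffel2018, §3 Cor. 1] -/
theorem expCutCount_lt_maxLevel_one_of_profile {R : Type*} [Fintype R] [DecidableEq R] [Nonempty R]
    {d s : ℕ} (hd : 0 < d) (hs : 0 < s) {A : Rule R} {qZ : ℕ → ℤ}
    (hA : IsSymmetric A (fun n => (qZ n : ℝ) / s) (d + 1))
    (h : profA (d + 1) qZ ^ 2 ≤ profB (d + 1) qZ ^ 2 ∨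
      (profA (d + 1) qZ ^ 2 - profB (d + 1) qZ ^ 2) ^ 2 * ((d : ℤ) + 1) ^ (d + 1)
        < 4 * (s : ℤ) ^ 4 * 16 ^ d * (d : ℤ) ^ d)
    (hreg : G.IsRegularOfDegree (d + 1)) (hG : G.CliqueFree 3) (hE : G.edgeFinset.Nonempty) :
    expCutCount G A < maxLevel G 1 := by
  rw [maxLevel_one_eq_of_regular_cliqueFree G hd hreg hG,
    expCutCount_eq_of_profile G (by omega) hs hA hreg hG, Nat.add_sub_cancel]
  have hEpos : (0 : ℝ) < #G.edgeFinset := by exact_mod_cast card_pos.2 hE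
  apply mul_lt_mul_of_pos_left _ hEpos
  have hs' : (0 : ℝ) < s := by exact_mod_cast hs
  have hr : 0 < regularMax d := regularMax_pos' hd
  have h' : (profA (d + 1) qZ : ℝ) ^ 2 ≤ (profB (d + 1) qZ : ℝ) ^ 2 ∨
      ((profA (d + 1) qZ : ℝ) ^ 2 - (profB (d + 1) qZ : ℝ) ^ 2) ^ 2 * ((d : ℝ) + 1) ^ (d + 1)
        < 4 * (s : ℝ) ^ 4 * 16 ^ d * (d : ℝ) ^ d := by
    rcases h with h | h
    · exact Or.inl (by exact_mod_cast h)
    · exact Or.inr (by exact_mod_cast h)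
  set a : ℝ := (profA (d + 1) qZ : ℝ)
  set b : ℝ := (profB (d + 1) qZ : ℝ)
  set x : ℝ := (a ^ 2 - b ^ 2) / (2 * s ^ 2 * 4 ^ d) with hx
  have hrew : 1 / 2 + (a ^ 2 - b ^ 2) / (4 * (s : ℝ) ^ 2 * 4 ^ d) = 1 / 2 * (1 + x) := by
    rw [hx]; field_simp; ring
  rw [hrew]
  suffices hxlt : x < regularMax d by linarith
  rcases h' with h' | h'
  · have hab : a ^ 2 - b ^ 2 ≤ 0 := by linarith
    have : x ≤ 0 := div_nonpos_of_nonpos_of_nonneg hab (by positivity)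
    linarith
  · by_cases hx0 : x ≤ 0
    · linarith
    have hsq : x ^ 2 < regularMax d ^ 2 := by
      rw [regularMax_sq', hx, div_pow, div_lt_div_iff₀ (by positivity) (by positivity)]
      calc (a ^ 2 - b ^ 2) ^ 2 * ((d : ℝ) + 1) ^ (d + 1)
          < 4 * (s : ℝ) ^ 4 * 16 ^ d * (d : ℝ) ^ d := h'
        _ = (d : ℝ) ^ d * (2 * (s : ℝ) ^ 2 * 4 ^ d) ^ 2 := by rw [← four_pow_sq]; ring
    exact (pow_lt_pow_iff_left₀ (not_le.1 hx0).le (regularMax_nonneg' d) two_ne_zero).1 hsq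

/-- **Integer criterion: a TIE.** If `b² ≤ a²` and `(a² − b²)² (d+1)^{d+1} = 4 s⁴ 16^d d^d` then the
rule's expected number of cut edges equals `M₁`. [cite: Hastings2019BoundedDepth, §3 (“for D = 2,
both the algorithms have the same performance”)] [cite: WangHadfieldJiangRieffel2018, §3 Cor. 1] -/
theorem expCutCount_eq_maxLevel_one_of_profile {R : Type*} [Fintype R] [DecidableEq R] [Nonempty R]
    {d s : ℕ} (hd : 0 < d) (hs : 0 < s) {A : Rule R} {qZ : ℕ → ℤ}
    (hA : IsSymmetric A (fun n => (qZ n : ℝ) / s) (d + 1))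
    (hb : profB (d + 1) qZ ^ 2 ≤ profA (d + 1) qZ ^ 2)
    (h : (profA (d + 1) qZ ^ 2 - profB (d + 1) qZ ^ 2) ^ 2 * ((d : ℤ) + 1) ^ (d + 1)
      = 4 * (s : ℤ) ^ 4 * 16 ^ d * (d : ℤ) ^ d)
    (hreg : G.IsRegularOfDegree (d + 1)) (hG : G.CliqueFree 3) :
    expCutCount G A = maxLevel G 1 := by
  rw [maxLevel_one_eq_of_regular_cliqueFree G hd hreg hG,
    expCutCount_eq_of_profile G (by omega) hs hA hreg hG, Nat.add_sub_cancel]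
  congr 1
  have hs' : (0 : ℝ) < s := by exact_mod_cast hs
  have hb' : (profB (d + 1) qZ : ℝ) ^ 2 ≤ (profA (d + 1) qZ : ℝ) ^ 2 := by exact_mod_cast hb
  have h' : ((profA (d + 1) qZ : ℝ) ^ 2 - (profB (d + 1) qZ : ℝ) ^ 2) ^ 2 * ((d : ℝ) + 1) ^ (d + 1)
      = 4 * (s : ℝ) ^ 4 * 16 ^ d * (d : ℝ) ^ d := by
    exact_mod_cast h
  set a : ℝ := (profA (d + 1) qZ : ℝ)
  set b : ℝ := (profB (d + 1) qZ : ℝ)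
  set x : ℝ := (a ^ 2 - b ^ 2) / (2 * s ^ 2 * 4 ^ d) with hx
  have hrew : 1 / 2 + (a ^ 2 - b ^ 2) / (4 * (s : ℝ) ^ 2 * 4 ^ d) = 1 / 2 * (1 + x) := by
    rw [hx]; field_simp; ring
  rw [hrew]
  suffices hxe : x = regularMax d by rw [hxe]
  have hx0 : 0 ≤ x := by
    have hab : 0 ≤ a ^ 2 - b ^ 2 := by linarith
    positivity
  have hsq : x ^ 2 = regularMax d ^ 2 := by
    rw [regularMax_sq', hx, div_pow, div_eq_div_iff (by positivity) (by positivity), h', ← four_pow_sq]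
    ring
  exact (pow_left_inj₀ hx0 (regularMax_nonneg' d) two_ne_zero).1 hsq

/-! ## The threshold algorithm `𝒜_τ` against QAOA₁ (Hastings 2019, §3 and Appendix table) -/

/-- The integer spin profile of the threshold rule: `+1` below `τ`, `−1` from `τ` on. [cite:
Hastings2019BoundedDepth, §3.3 (“The threshold algorithm has q(j) ∈ {−1,+1}”)] -/
def thrZ (τ : ℕ) (n : ℕ) : ℤ := if n < τ then 1 else -1

/-- The threshold rule is spin-symmetric with the integer profile `thrZ τ` (scale `s = 1`). [cite:
Hastings2019BoundedDepth, §3.3] -/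
theorem thresholdRule_symmetric_thrZ (τ D : ℕ) :
    IsSymmetric (thresholdRule τ) (fun n => (thrZ τ n : ℝ) / (1 : ℕ)) D := by
  have h : (fun n => (thrZ τ n : ℝ) / (1 : ℕ)) = thresholdQ τ := by
    funext n
    unfold thrZ thresholdQ
    split_ifs <;> norm_num
  rw [h]
  exact thresholdRule_symmetric τ D

/-- For `τ > D` the threshold rule never flips, and `a = b` (`𝒜_τ` outputs the uniform random cut,
value `½`). [cite: HirvonenRybickiSchmidSuomela2017, §2.6 (“α(d+1, d) = ½, as the threshold value τ =
d+1 simply means that algorithm 𝒜_τ outputs a uniform random cut”)] -/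
theorem profA_thrZ_eq_profB {D τ : ℕ} (h : D + 1 ≤ τ) : profA D (thrZ τ) = profB D (thrZ τ) := by
  unfold profA profB
  refine sum_congr rfl fun n hn => ?_
  rw [mem_range] at hn
  simp [thrZ, show n < τ by omega, show n + 1 < τ by omega]

/-- **Hastings 2019, §3 / Appendix: the one-round threshold algorithm BEATS the level-1 QAOA on
every triangle-free `D`-regular graph for `D = 5, 7, 8, 9, 10, 12, 13, …, 19`** (with the thresholds
`τ = 4, 5, 6, 6, 7, 8, 9, 9, 10, 10, 11, 11, 12`): the expected number of cut edges of `𝒜_τ` — a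
classical algorithm using one random bit per vertex and one round — is STRICTLY larger than `M₁ =
max_{γ,β} F₁(γ,β)`. Listed as pairs `(d, τ)` with `D = d + 1`. (“we find that for all choices of
`3 ≤ D ≤ 1000` that this threshold algorithm outperforms the QAOA with the exceptions of `D =
3,4,6,11`”; the paper's table stops at `D = 19`; each case is an exact integer inequality checked by
the kernel.) [cite: Hastings2019BoundedDepth, §3 and Appendix “Numerical Results for Triangle Free
MAX-CUT”] -/
theorem maxLevel_one_lt_expCutCount_threshold {d τ : ℕ}
    (hmem : (d, τ) ∈ ({(4, 4), (6, 5), (7, 6), (8, 6), (9, 7), (11, 8), (12, 9), (13, 9), (14, 10),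
      (15, 10), (16, 11), (17, 11), (18, 12)} : Finset (ℕ × ℕ)))
    (hreg : G.IsRegularOfDegree (d + 1)) (hG : G.CliqueFree 3) (hE : G.edgeFinset.Nonempty) :
    maxLevel G 1 < expCutCount G (thresholdRule τ) := by
  simp only [mem_insert, mem_singleton, Prod.mk.injEq] at hmem
  rcases hmem with ⟨rfl, rfl⟩ | ⟨rfl, rfl⟩ | ⟨rfl, rfl⟩ | ⟨rfl, rfl⟩ | ⟨rfl, rfl⟩ | ⟨rfl, rfl⟩ |
    ⟨rfl, rfl⟩ | ⟨rfl, rfl⟩ | ⟨rfl, rfl⟩ | ⟨rfl, rfl⟩ | ⟨rfl, rfl⟩ | ⟨rfl, rfl⟩ | ⟨rfl, rfl⟩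
  all_goals
    exact maxLevel_one_lt_expCutCount_of_profile G (by norm_num) Nat.one_pos
      (thresholdRule_symmetric_thrZ _ _) (by decide) (by decide) hreg hG hE

/-- **… while for `D = 3, 4, 6, 11` the level-1 QAOA beats EVERY threshold `τ`** (“with the
exceptions of `D = 3,4,6,11` for which the QAOA is better”), again as exact integer inequalities
(`τ ≤ D + 1` case by case; larger `τ` give the uniform random cut). Pairs are indexed by `d = D − 1
∈ {2, 3, 5, 10}`. [cite: Hastings2019BoundedDepth, §3] -/
theorem expCutCount_threshold_lt_maxLevel_one {d : ℕ} (hmem : d ∈ ({2, 3, 5, 10} : Finset ℕ))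
    (τ : ℕ) (hreg : G.IsRegularOfDegree (d + 1)) (hG : G.CliqueFree 3) (hE : G.edgeFinset.Nonempty) :
    expCutCount G (thresholdRule τ) < maxLevel G 1 := by
  simp only [mem_insert, mem_singleton] at hmem
  rcases le_or_gt (d + 2) τ with hτ | hτ
  · have hd : 0 < d := by rcases hmem with rfl | rfl | rfl | rfl <;> norm_num
    exact expCutCount_lt_maxLevel_one_of_profile G hd Nat.one_pos (thresholdRule_symmetric_thrZ _ _)
      (Or.inl (by rw [profA_thrZ_eq_profB (by omega)])) hreg hG hE
  · rcases hmem with rfl | rfl | rfl | rfl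
    all_goals
      interval_cases τ
      all_goals
        exact expCutCount_lt_maxLevel_one_of_profile G (by norm_num) Nat.one_pos
          (thresholdRule_symmetric_thrZ _ _) (by decide) hreg hG hE

/-- **`D = 2`: a tie** (“for `D = 2`, both the algorithms have the same performance”): on unions of
cycles of length `≥ 4` the threshold rule `𝒜_2` and QAOA₁ both cut `¾ |E|` in expectation. [cite:
Hastings2019BoundedDepth, §3] [cite: FarhiGoldstoneGutmann2014, §4 (ring of disagrees, p = 1: 3/4)] -/
theorem expCutCount_threshold_two_eq_maxLevel_one (hreg : G.IsRegularOfDegree (1 + 1))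
    (hG : G.CliqueFree 3) : expCutCount G (thresholdRule 2) = maxLevel G 1 :=
  expCutCount_eq_maxLevel_one_of_profile G Nat.one_pos Nat.one_pos (thresholdRule_symmetric_thrZ 2 _)
    (by decide) (by decide) hreg hG

/-! ## Hastings' soft thresholds for `D = 6` and `D = 11` (§3.1) -/

/-- **Hastings' rule for `D = 11`**: “If at most 6 neighbors agree, then the spin does not flip. If
more than 8 neighbors agree, then the spin does flip. If 7 neighbors agree, then the spin flips with a
probability chosen so that its expectation value is equal to −0.1 times its initial value (i.e., it
flips with a probability 0.55)” — realised with a private uniform symbol `r ∈ Fin 20` (flip iff `r <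
11`); `8` agreeing neighbours (“more than 8”, read with the printed value `0.09868…`) flips. [cite:
Hastings2019BoundedDepth, §3.1] -/
def softRule11 : Rule (Fin 20) := fun N r =>
  if N.2 ≤ 6 then N.1 else if 8 ≤ N.2 then !N.1 else if (r : ℕ) < 11 then !N.1 else N.1

/-- The profile of `softRule11` times `10`: `q = 1, −0.1, −1` for `j ≤ 6`, `j = 7`, `j ≥ 8`. [cite:
Hastings2019BoundedDepth, §3.1] -/
def softQ11 (j : ℕ) : ℤ := if j ≤ 6 then 10 else if 8 ≤ j then -10 else -1

/-- **Hastings' rule for `D = 6`**, in the reading that reproduces the printed improvement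
`0.13018…`: no flip if at most `3` neighbours agree, flip if at least `5` agree, and if exactly `4`
agree flip with probability `0.35` (private symbol `r < 7` in `Fin 20`), i.e. mean spin `+0.3` times
the initial spin. SCOPE CAVEAT: the sentence as printed (“If at most 4 neighbors agree the spin does
not flip, if 5 or more neighbors agree the spin does flip, and if 4 neighbors agree then the spin flips
with probability 0.65”) is self-contradictory at `4`, and its literal `q(4) = −0.3` reading gives
improvement `0.12286… < 0.1294`; the value the paper reports, “improvement by a factor `0.13018…`”,
is exactly `2133/16384 = 0.13018798828125`, the value of the present rule (`q(4) = +0.3`, i.e. the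
spin KEEPS its value with probability `0.65`). [cite: Hastings2019BoundedDepth, §3.1] -/
def softRule6 : Rule (Fin 20) := fun N r =>
  if N.2 ≤ 3 then N.1 else if 5 ≤ N.2 then !N.1 else if (r : ℕ) < 7 then !N.1 else N.1

/-- The profile of `softRule6` times `10`: `q = 1, 0.3, −1` for `j ≤ 3`, `j = 4`, `j ≥ 5`. [cite:
Hastings2019BoundedDepth, §3.1] -/
def softQ6 (j : ℕ) : ℤ := if j ≤ 3 then 10 else if 5 ≤ j then -10 else 3

/-- `softRule11` is spin-symmetric with profile `softQ11/10`. [cite: Hastings2019BoundedDepth, §3.1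
(“its expectation value is equal to −0.1 times its initial value”)] -/
theorem softRule11_symmetric (D : ℕ) : IsSymmetric softRule11 (fun n => (softQ11 n : ℝ) / (10 : ℕ)) D := by
  intro k j _
  unfold meanSpin softRule11 softQ11
  rcases Nat.lt_or_ge j 7 with h7 | h7
  · have h1 : j ≤ 6 := by omega
    cases k <;> norm_num [h1, spin]
  · rcases Nat.lt_or_ge j 8 with h8 | h8
    · obtain rfl : j = 7 := by omega
      dsimp only
      simp only [show ¬((7 : ℕ) ≤ 6) from by norm_num, show ¬((8 : ℕ) ≤ 7) from by norm_num,
        if_false]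
      rw [Fin.sum_univ_eq_sum_range (fun i => spin (if i < 11 then !k else k)) 20]
      cases k <;> norm_num [Finset.sum_range_succ, spin]
    · cases k <;> norm_num [show ¬ j ≤ 6 by omega, h8, spin]

/-- `softRule6` is spin-symmetric with profile `softQ6/10`. [cite: Hastings2019BoundedDepth, §3.1] -/
theorem softRule6_symmetric (D : ℕ) : IsSymmetric softRule6 (fun n => (softQ6 n : ℝ) / (10 : ℕ)) D := by
  intro k j _
  unfold meanSpin softRule6 softQ6
  rcases Nat.lt_or_ge j 4 with h4 | h4
  · have h1 : j ≤ 3 := by omega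
    cases k <;> norm_num [h1, spin]
  · rcases Nat.lt_or_ge j 5 with h5 | h5
    · obtain rfl : j = 4 := by omega
      dsimp only
      simp only [show ¬((4 : ℕ) ≤ 3) from by norm_num, show ¬((5 : ℕ) ≤ 4) from by norm_num,
        if_false]
      rw [Fin.sum_univ_eq_sum_range (fun i => spin (if i < 7 then !k else k)) 20]
      cases k <;> norm_num [Finset.sum_range_succ, spin]
    · cases k <;> norm_num [show ¬ j ≤ 3 by omega, h5, spin]

/-- **`D = 11`: Hastings' soft threshold cuts `|E| · (½ + 0.09868…)` edges in expectation**, exactly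
`|E| · (½ + 413919/4194304)` (“This led to an improvement over random by `0.09868…`”). [cite:
Hastings2019BoundedDepth, §3.1] -/
theorem expCutCount_softRule11 (hreg : G.IsRegularOfDegree 11) (hG : G.CliqueFree 3) :
    expCutCount G softRule11 = #G.edgeFinset * (1 / 2 + 413919 / 4194304) := by
  rw [expCutCount_eq_of_profile G (by norm_num) (by norm_num) (softRule11_symmetric 11) hreg hG,
    show profA 11 softQ11 = 7800 by decide, show profB 11 softQ11 = 4410 by decide]
  norm_num

/-- **`D = 6`: Hastings' soft threshold cuts `|E| · (½ + 0.13018…)` edges in expectation**, exactly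
`|E| · (½ + 2133/16384)`, `2133/16384 = 0.13018798828125` (“This led to an improvement by a factor
`0.13018…`”). [cite: Hastings2019BoundedDepth, §3.1] -/
theorem expCutCount_softRule6 (hreg : G.IsRegularOfDegree 6) (hG : G.CliqueFree 3) :
    expCutCount G softRule6 = #G.edgeFinset * (1 / 2 + 2133 / 16384) := by
  rw [expCutCount_eq_of_profile G (by norm_num) (by norm_num) (softRule6_symmetric 6) hreg hG,
    show profA 6 softQ6 = 265 by decide, show profB 6 softQ6 = 130 by decide]
  norm_num

/-- **`D = 11`: a one-round classical local rule beats QAOA₁** (“`0.09868…`, which is larger than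
the value `0.0936` for the QAOA”). [cite: Hastings2019BoundedDepth, §3.1] -/
theorem maxLevel_one_lt_expCutCount_softRule11 (hreg : G.IsRegularOfDegree 11) (hG : G.CliqueFree 3)
    (hE : G.edgeFinset.Nonempty) : maxLevel G 1 < expCutCount G softRule11 :=
  maxLevel_one_lt_expCutCount_of_profile G (d := 10) (by norm_num) (by norm_num)
    (softRule11_symmetric 11) (by decide) (by decide) hreg hG hE

/-- **`D = 6`: a one-round classical local rule beats QAOA₁** (“`0.13018…`, again larger than the
value `0.1294` for the QAOA”). [cite: Hastings2019BoundedDepth, §3.1] -/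
theorem maxLevel_one_lt_expCutCount_softRule6 (hreg : G.IsRegularOfDegree 6) (hG : G.CliqueFree 3)
    (hE : G.edgeFinset.Nonempty) : maxLevel G 1 < expCutCount G softRule6 :=
  maxLevel_one_lt_expCutCount_of_profile G (d := 5) (by norm_num) (by norm_num)
    (softRule6_symmetric 6) (by decide) (by decide) hreg hG hE

/-! ## Hastings' discrete local tensor rule for `D = 3, 4` (§3.2–§3.3) -/

/-- The four initial values `{−1, −1/3, +1/3, +1}`, scaled by `3` to the integers `−3, −1, 1, 3`.
[cite: Hastings2019BoundedDepth, §3.3 (“choosing uniformly from `{−1,−1/3,+1/3,+1}`”)] -/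
def tensorW (a : Fin 4) : ℤ := 2 * (a : ℤ) - 3

/-- Hastings' one-step local tensor rule with `c = 0.599`: `Z_i = sign((v⃗₁)_i)`, `(v⃗₁)_i = (v⃗₀)_i −
c Σ_{j∼i} (v⃗₀)_j` (`J_{ij} = −1` on edges), in exact integer arithmetic after scaling by `3000`: output
`+` iff `1000 · (3v_i) − 599 · Σ_j (3v_j) > 0` (the left side is never `0` for `D = 3, 4`). [cite:
Hastings2019BoundedDepth, §3.2 (“`v⃗₁ = v⃗₀ + c J · v⃗₀`, and set `Z_i` to equal the sign of `(v⃗₁)_i`”)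
and §3.3 (“with `c = 0.599`”)] -/
def tensorF (a : Fin 4) (z : ℤ) : Bool := decide (0 < 1000 * tensorW a - 599 * z)

/-- Kernel evaluation, `D = 3`: `Σ_{a,b} localSumZ(a,b) localSumZ(b,a) = −1600` (`4² · 4⁴` spin
products). [cite: Hastings2019BoundedDepth, §3.3 (“exactly enumerated”)] -/
theorem pairSumZ_tensor_three : pairSumZ 3 tensorW tensorF = -1600 := by
  decide +kernel

/-- Kernel evaluation, `D = 4`: `Σ_{a,b} localSumZ(a,b) localSumZ(b,a) = −21768`. [cite:
Hastings2019BoundedDepth, §3.3 (“exactly enumerated”)] -/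
theorem pairSumZ_tensor_four : pairSumZ 4 tensorW tensorF = -21768 := by
  decide +kernel

/-- **`D = 3`: Hastings' discrete local tensor rule cuts `89/128 = 0.6953125` of the edges in
expectation** on every triangle-free `3`-regular graph (kernel evaluation: `pairSumZ = −1600`,
`½ + 1600/(2·4⁶)`). [cite: Hastings2019BoundedDepth, §3.3 (“gives an algorithm whose performance can be
exactly enumerated and one finds (with `c = 0.599`) that it outperforms that QAOA”)] -/
theorem vexpCutCount_tensor_three (hreg : G.IsRegularOfDegree 3) (hG : G.CliqueFree 3) :
    vexpCutCount G tensorW tensorF = #G.edgeFinset * (89 / 128) := by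
  rw [vexpCutCount_eq_int G (by norm_num) hreg hG, pairSumZ_tensor_three,
    Fintype.card_fin]
  norm_num

/-- **`D = 4`: the same rule cuts `10913/16384 = 0.66607…` of the edges in expectation** on every
triangle-free `4`-regular graph (`pairSumZ = −21768`). [cite: Hastings2019BoundedDepth, §3.3] -/
theorem vexpCutCount_tensor_four (hreg : G.IsRegularOfDegree 4) (hG : G.CliqueFree 3) :
    vexpCutCount G tensorW tensorF = #G.edgeFinset * (10913 / 16384) := by
  rw [vexpCutCount_eq_int G (by norm_num) hreg hG, pairSumZ_tensor_four,
    Fintype.card_fin]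
  norm_num

/-- **Integer criterion for valued rules: the rule BEATS QAOA₁** on triangle-free `(d+1)`-regular graphs
when `T = pairSumZ < 0` and `d^d |β|^{4(d+1)} < T² (d+1)^{d+1}`. [cite: Hastings2019BoundedDepth, §3.2]
[cite: WangHadfieldJiangRieffel2018, §3 Cor. 1] -/
theorem maxLevel_one_lt_vexpCutCount_of_int {β : Type*} [Fintype β] [DecidableEq β] [Nonempty β]
    {d : ℕ} (hd : 0 < d) {φ : β → ℤ} {F : β → ℤ → Bool}
    (hT : pairSumZ (d + 1) φ F < 0)
    (h : (d : ℤ) ^ d * (Fintype.card β : ℤ) ^ (4 * (d + 1))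
      < pairSumZ (d + 1) φ F ^ 2 * ((d : ℤ) + 1) ^ (d + 1))
    (hreg : G.IsRegularOfDegree (d + 1)) (hG : G.CliqueFree 3) (hE : G.edgeFinset.Nonempty) :
    maxLevel G 1 < vexpCutCount G φ F := by
  rw [maxLevel_one_eq_of_regular_cliqueFree G hd hreg hG,
    vexpCutCount_eq_int G (by omega) hreg hG]
  have hEpos : (0 : ℝ) < #G.edgeFinset := by exact_mod_cast card_pos.2 hE
  apply mul_lt_mul_of_pos_left _ hEpos
  have hc : (0 : ℝ) < Fintype.card β := by exact_mod_cast Fintype.card_pos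
  have hT' : (pairSumZ (d + 1) φ F : ℝ) < 0 := by exact_mod_cast hT
  have h' : (d : ℝ) ^ d * (Fintype.card β : ℝ) ^ (4 * (d + 1))
      < (pairSumZ (d + 1) φ F : ℝ) ^ 2 * ((d : ℝ) + 1) ^ (d + 1) := by exact_mod_cast h
  set T : ℝ := (pairSumZ (d + 1) φ F : ℝ)
  set y : ℝ := -T / (Fintype.card β : ℝ) ^ (2 * (d + 1)) with hy
  have hy0 : 0 < y := div_pos (by linarith) (by positivity)
  have hsq : regularMax d ^ 2 < y ^ 2 := by
    rw [regularMax_sq', hy, div_pow, neg_sq, div_lt_div_iff₀ (by positivity) (by positivity)]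
    calc (d : ℝ) ^ d * ((Fintype.card β : ℝ) ^ (2 * (d + 1))) ^ 2
        = (d : ℝ) ^ d * (Fintype.card β : ℝ) ^ (4 * (d + 1)) := by rw [← pow_mul]; ring_nf
      _ < T ^ 2 * ((d : ℝ) + 1) ^ (d + 1) := h'
  have hlt : regularMax d < y := (pow_lt_pow_iff_left₀ (regularMax_nonneg' d) hy0.le two_ne_zero).1 hsq
  have hrew : 1 / 2 - T / (2 * (Fintype.card β : ℝ) ^ (2 * (d + 1))) = 1 / 2 * (1 + y) := by
    rw [hy]; field_simp; ring
  rw [hrew]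
  linarith

/-- **`D = 3`: Hastings' discrete local tensor rule beats QAOA₁** on every triangle-free `3`-regular
graph (`89/128 = 0.69531… > ½(1 + 2/(3√3)) = 0.69245…`, the paper's `0.1925` improvement of QAOA₁).
[cite: Hastings2019BoundedDepth, §3.2–§3.3] -/
theorem maxLevel_one_lt_vexpCutCount_tensor_three (hreg : G.IsRegularOfDegree 3) (hG : G.CliqueFree 3)
    (hE : G.edgeFinset.Nonempty) : maxLevel G 1 < vexpCutCount G tensorW tensorF :=
  maxLevel_one_lt_vexpCutCount_of_int G (d := 2) (by norm_num)
    (by rw [pairSumZ_tensor_three]; norm_num)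
    (by rw [pairSumZ_tensor_three, Fintype.card_fin]; norm_num) hreg hG hE

/-- **`D = 4`: Hastings' discrete local tensor rule beats QAOA₁** on every triangle-free `4`-regular
graph (`10913/16384 = 0.66607… > ½(1 + regularMax 3) = 0.66237…`, the paper's `0.1624`). [cite:
Hastings2019BoundedDepth, §3.2–§3.3] -/
theorem maxLevel_one_lt_vexpCutCount_tensor_four (hreg : G.IsRegularOfDegree 4) (hG : G.CliqueFree 3)
    (hE : G.edgeFinset.Nonempty) : maxLevel G 1 < vexpCutCount G tensorW tensorF :=
  maxLevel_one_lt_vexpCutCount_of_int G (d := 3) (by norm_num)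
    (by rw [pairSumZ_tensor_four]; norm_num)
    (by rw [pairSumZ_tensor_four, Fintype.card_fin]; norm_num) hreg hG hE

/-! ## Hastings 2019, §3: the whole table range -/

/-- **For every degree `3 ≤ D ≤ 19`, some ONE-ROUND classical local algorithm beats the level-1 QAOA
on every triangle-free `D`-regular graph** — the threshold rule `𝒜_τ` (`D ∉ {3,4,6,11}`), Hastings'
soft thresholds (`D = 6, 11`) or his discrete local tensor rule (`D = 3, 4`): “we will show that a
local classical algorithm beats this QAOA for all values of `D`” (here: the degrees of the paper's
table; `D = 2` is a tie, `expCutCount_threshold_two_eq_maxLevel_one`). [cite: Hastings2019BoundedDepth,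
§3 and Appendix] -/
theorem hastings_local_beats_qaoa_one {D : ℕ} (hD : 3 ≤ D) (hD' : D ≤ 19)
    (hreg : G.IsRegularOfDegree D) (hG : G.CliqueFree 3) (hE : G.edgeFinset.Nonempty) :
    (∃ τ, maxLevel G 1 < expCutCount G (thresholdRule τ)) ∨
      maxLevel G 1 < expCutCount G softRule6 ∨ maxLevel G 1 < expCutCount G softRule11 ∨
      maxLevel G 1 < vexpCutCount G tensorW tensorF := by
  interval_cases D
  · exact Or.inr (Or.inr (Or.inr (maxLevel_one_lt_vexpCutCount_tensor_three G hreg hG hE)))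
  · exact Or.inr (Or.inr (Or.inr (maxLevel_one_lt_vexpCutCount_tensor_four G hreg hG hE)))
  · exact Or.inl ⟨4, maxLevel_one_lt_expCutCount_threshold G (d := 4) (by decide) hreg hG hE⟩
  · exact Or.inr (Or.inl (maxLevel_one_lt_expCutCount_softRule6 G hreg hG hE))
  · exact Or.inl ⟨5, maxLevel_one_lt_expCutCount_threshold G (d := 6) (by decide) hreg hG hE⟩
  · exact Or.inl ⟨6, maxLevel_one_lt_expCutCount_threshold G (d := 7) (by decide) hreg hG hE⟩
  · exact Or.inl ⟨6, maxLevel_one_lt_expCutCount_threshold G (d := 8) (by decide) hreg hG hE⟩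
  · exact Or.inl ⟨7, maxLevel_one_lt_expCutCount_threshold G (d := 9) (by decide) hreg hG hE⟩
  · exact Or.inr (Or.inr (Or.inl (maxLevel_one_lt_expCutCount_softRule11 G hreg hG hE)))
  · exact Or.inl ⟨8, maxLevel_one_lt_expCutCount_threshold G (d := 11) (by decide) hreg hG hE⟩
  · exact Or.inl ⟨9, maxLevel_one_lt_expCutCount_threshold G (d := 12) (by decide) hreg hG hE⟩
  · exact Or.inl ⟨9, maxLevel_one_lt_expCutCount_threshold G (d := 13) (by decide) hreg hG hE⟩
  · exact Or.inl ⟨10, maxLevel_one_lt_expCutCount_threshold G (d := 14) (by decide) hreg hG hE⟩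
  · exact Or.inl ⟨10, maxLevel_one_lt_expCutCount_threshold G (d := 15) (by decide) hreg hG hE⟩
  · exact Or.inl ⟨11, maxLevel_one_lt_expCutCount_threshold G (d := 16) (by decide) hreg hG hE⟩
  · exact Or.inl ⟨11, maxLevel_one_lt_expCutCount_threshold G (d := 17) (by decide) hreg hG hE⟩
  · exact Or.inl ⟨12, maxLevel_one_lt_expCutCount_threshold G (d := 18) (by decide) hreg hG hE⟩

/-! ## Two-sided form at `D = 3, 4`: QAOA₁ beats EVERY deterministic one-round rule -/

/-- **`D = 3`: the level-1 QAOA beats every algorithm of HRSS's one-round model** (one random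
bit per node, one round, deterministic output rule) on every triangle-free `3`-regular graph with an
edge: `𝔼[#cut(𝒜)] ≤ 𝔼[#cut(𝒜_3)] = 11/16·|E| < M₁ = 0.6924…·|E|` — Hastings' “exceptions
`D = 3, 4` … for which the QAOA is better” combined with HRSS's “best possible algorithm for this
value of `d`”. [cite: Hastings2019BoundedDepth, §3 (“with the exceptions of D = 3, 4, 6, 11 for
which the QAOA is better”)] [cite: HirvonenRybickiSchmidSuomela2017, §2.5 (“This is also the best
possible algorithm for this value of d, for the model of computing that we defined”)] -/
theorem expCutCount_rule_lt_maxLevel_one_three (hreg : G.IsRegularOfDegree 3) (hG : G.CliqueFree 3)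
    (hE : G.edgeFinset.Nonempty) (A : Rule Unit) : expCutCount G A < maxLevel G 1 :=
  (Literature.Combinatorics.SimpleGraph.TriangleFreeLocalCutOptimal.expCutCount_le_expCutCount_threshold_three
    G hreg hG A).trans_lt
    (expCutCount_threshold_lt_maxLevel_one G (d := 2) (by decide) 3 hreg hG hE)

/-- **`D = 4`: the level-1 QAOA beats every algorithm of HRSS's one-round model** on every
triangle-free `4`-regular graph with an edge (`𝔼[#cut(𝒜)] ≤ 41/64·|E| < M₁ = 0.6624…·|E|`).
[cite: Hastings2019BoundedDepth, §3] [cite: HirvonenRybickiSchmidSuomela2017, §2.5] -/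
theorem expCutCount_rule_lt_maxLevel_one_four (hreg : G.IsRegularOfDegree 4) (hG : G.CliqueFree 3)
    (hE : G.edgeFinset.Nonempty) (A : Rule Unit) : expCutCount G A < maxLevel G 1 :=
  (Literature.Combinatorics.SimpleGraph.TriangleFreeLocalCutOptimal.expCutCount_le_expCutCount_threshold_four
    G hreg hG A).trans_lt
    (expCutCount_threshold_lt_maxLevel_one G (d := 3) (by decide) 3 hreg hG hE)

/-! ## Larger degrees: `20 ≤ D ≤ 100` by fast binomials -/

/-- `C(m, n)` by the falling-factorial formula, for kernel evaluation at larger `D` (the recursive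
`Nat.choose` is exponential to unfold). [cite: Hastings2019BoundedDepth, §3 (“for all choices of
3 ≤ D ≤ 1000”)] -/
def chooseFast (m n : ℕ) : ℕ := m.descFactorial n / n.factorial

/-- `chooseFast = Nat.choose`. [cite: Hastings2019BoundedDepth, §3] -/
theorem chooseFast_eq (m n : ℕ) : chooseFast m n = m.choose n :=
  (Nat.choose_eq_descFactorial_div_factorial m n).symm

/-- `profA` with fast binomials. [cite: Hastings2019BoundedDepth, §3.3] -/
def profAFast (D : ℕ) (qZ : ℕ → ℤ) : ℤ := ∑ n ∈ range D, (chooseFast (D - 1) n : ℤ) * qZ n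

/-- `profB` with fast binomials. [cite: Hastings2019BoundedDepth, §3.3] -/
def profBFast (D : ℕ) (qZ : ℕ → ℤ) : ℤ := ∑ n ∈ range D, (chooseFast (D - 1) n : ℤ) * qZ (n + 1)

/-- `profA = profAFast`. [cite: Hastings2019BoundedDepth, §3.3] -/
theorem profA_eq_fast (D : ℕ) (qZ : ℕ → ℤ) : profA D qZ = profAFast D qZ := by
  unfold profA profAFast
  simp_rw [chooseFast_eq]

/-- `profB = profBFast`. [cite: Hastings2019BoundedDepth, §3.3] -/
theorem profB_eq_fast (D : ℕ) (qZ : ℕ → ℤ) : profB D qZ = profBFast D qZ := by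
  unfold profB profBFast
  simp_rw [chooseFast_eq]

/-- **The threshold algorithm beats QAOA₁ on every triangle-free `D`-regular graph for every
`20 ≤ D ≤ 100`** (thresholds `τ` as listed, pairs `(d, τ)` with `D = d + 1`; “we find that for all
choices of `3 ≤ D ≤ 1000` that this threshold algorithm outperforms the QAOA with the exceptions of
`D = 3,4,6,11`” — here kernel-checked up to `D = 100` as exact integer inequalities, the binomials
evaluated by falling factorials). [cite: Hastings2019BoundedDepth, §3] -/
theorem maxLevel_one_lt_expCutCount_threshold_large {d τ : ℕ}
    (hmem : (d, τ) ∈ ({(19, 12), (20, 13), (21, 14), (22, 14), (23, 15), (24, 15), (25, 16), (26, 16), (27, 17), (28, 17), (29, 18), (30, 18), (31, 19), (32, 20), (33, 20), (34, 21), (35, 21), (36, 22), (37, 22), (38, 23), (39, 23), (40, 24), (41, 24), (42, 25), (43, 25), (44, 26), (45, 26), (46, 27), (47, 28), (48, 28), (49, 29), (50, 29), (51, 30), (52, 30), (53, 31), (54, 31), (55, 32), (56, 32), (57, 33), (58, 33), (59, 34), (60, 34), (61, 35), (62, 35), (63, 36), (64, 37), (65, 37), (66, 38), (67, 38), (68,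 39), (69, 39), (70, 40), (71, 40), (72, 41), (73, 41), (74, 42), (75, 42), (76, 43), (77, 43), (78, 44), (79, 44), (80, 45), (81, 45), (82, 46), (83, 47), (84, 47), (85, 48), (86, 48), (87, 49), (88, 49), (89, 50), (90, 50), (91, 51), (92, 51), (93, 52), (94, 52), (95, 53), (96, 53), (97, 54), (98, 54), (99, 55)} : Finset (ℕ × ℕ)))
    (hreg : G.IsRegularOfDegree (d + 1)) (hG : G.CliqueFree 3) (hE : G.edgeFinset.Nonempty) :
    maxLevel G 1 < expCutCount G (thresholdRule τ) := by
  simp only [mem_insert, mem_singleton, Prod.mk.injEq] at hmem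
  rcases hmem with ⟨rfl, rfl⟩ |
    ⟨rfl, rfl⟩ |
    ⟨rfl, rfl⟩ |
    ⟨rfl, rfl⟩ |
    ⟨rfl, rfl⟩ |
    ⟨rfl, rfl⟩ |
    ⟨rfl, rfl⟩ |
    ⟨rfl, rfl⟩ |
    ⟨rfl, rfl⟩ |
    ⟨rfl, rfl⟩ |
    ⟨rfl, rfl⟩ |
    ⟨rfl, rfl⟩ |
    ⟨rfl, rfl⟩ |
    ⟨rfl, rfl⟩ |
    ⟨rfl, rfl⟩ |
    ⟨rfl, rfl⟩ |
    ⟨rfl, rfl⟩ |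
    ⟨rfl, rfl⟩ |
    ⟨rfl, rfl⟩ |
    ⟨rfl, rfl⟩ |
    ⟨rfl, rfl⟩ |
    ⟨rfl, rfl⟩ |
    ⟨rfl, rfl⟩ |
    ⟨rfl, rfl⟩ |
    ⟨rfl, rfl⟩ |
    ⟨rfl, rfl⟩ |
    ⟨rfl, rfl⟩ |
    ⟨rfl, rfl⟩ |
    ⟨rfl, rfl⟩ |
    ⟨rfl, rfl⟩ |
    ⟨rfl, rfl⟩ |
    ⟨rfl, rfl⟩ |
    ⟨rfl, rfl⟩ |
    ⟨rfl, rfl⟩ |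
    ⟨rfl, rfl⟩ |
    ⟨rfl, rfl⟩ |
    ⟨rfl, rfl⟩ |
    ⟨rfl, rfl⟩ |
    ⟨rfl, rfl⟩ |
    ⟨rfl, rfl⟩ |
    ⟨rfl, rfl⟩ |
    ⟨rfl, rfl⟩ |
    ⟨rfl, rfl⟩ |
    ⟨rfl, rfl⟩ |
    ⟨rfl, rfl⟩ |
    ⟨rfl, rfl⟩ |
    ⟨rfl, rfl⟩ |
    ⟨rfl, rfl⟩ |
    ⟨rfl, rfl⟩ |
    ⟨rfl, rfl⟩ |
    ⟨rfl, rfl⟩ |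
    ⟨rfl, rfl⟩ |
    ⟨rfl, rfl⟩ |
    ⟨rfl, rfl⟩ |
    ⟨rfl, rfl⟩ |
    ⟨rfl, rfl⟩ |
    ⟨rfl, rfl⟩ |
    ⟨rfl, rfl⟩ |
    ⟨rfl, rfl⟩ |
    ⟨rfl, rfl⟩ |
    ⟨rfl, rfl⟩ |
    ⟨rfl, rfl⟩ |
    ⟨rfl, rfl⟩ |
    ⟨rfl, rfl⟩ |
    ⟨rfl, rfl⟩ |
    ⟨rfl, rfl⟩ |
    ⟨rfl, rfl⟩ |
    ⟨rfl, rfl⟩ |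
    ⟨rfl, rfl⟩ |
    ⟨rfl, rfl⟩ |
    ⟨rfl, rfl⟩ |
    ⟨rfl, rfl⟩ |
    ⟨rfl, rfl⟩ |
    ⟨rfl, rfl⟩ |
    ⟨rfl, rfl⟩ |
    ⟨rfl, rfl⟩ |
    ⟨rfl, rfl⟩ |
    ⟨rfl, rfl⟩ |
    ⟨rfl, rfl⟩ |
    ⟨rfl, rfl⟩ |
    ⟨rfl, rfl⟩
  all_goals
    refine maxLevel_one_lt_expCutCount_of_profile G (by norm_num) Nat.one_pos
      (thresholdRule_symmetric_thrZ _ _) ?_ ?_ hreg hG hE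
    · rw [profA_eq_fast, profB_eq_fast]
      decide +kernel
    · rw [profA_eq_fast, profB_eq_fast]
      decide +kernel

set_option maxHeartbeats 1600000 in
/-- **Hastings 2019, §3 for every `3 ≤ D ≤ 100`**: some one-round classical local rule (threshold,
soft threshold, or the discrete tensor rule) beats the level-1 QAOA on every triangle-free
`D`-regular graph with an edge. [cite: Hastings2019BoundedDepth, §3 (“we will show that a local
classical algorithm beats this QAOA for all values of D”; threshold comparison “for all choices of
3 ≤ D ≤ 1000”)] -/
theorem hastings_local_beats_qaoa_one_le_hundred {D : ℕ} (hD : 3 ≤ D) (hD' : D ≤ 100)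
    (hreg : G.IsRegularOfDegree D) (hG : G.CliqueFree 3) (hE : G.edgeFinset.Nonempty) :
    (∃ τ, maxLevel G 1 < expCutCount G (thresholdRule τ)) ∨
      maxLevel G 1 < expCutCount G softRule6 ∨ maxLevel G 1 < expCutCount G softRule11 ∨
      maxLevel G 1 < vexpCutCount G tensorW tensorF := by
  by_cases h19 : D ≤ 19
  · exact hastings_local_beats_qaoa_one G hD h19 hreg hG hE
  · push Not at h19
    left
    interval_cases D
    · exact ⟨12, maxLevel_one_lt_expCutCount_threshold_large G (d := 19) (by decide +kernel) hreg hG hE⟩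
    · exact ⟨13, maxLevel_one_lt_expCutCount_threshold_large G (d := 20) (by decide +kernel) hreg hG hE⟩
    · exact ⟨14, maxLevel_one_lt_expCutCount_threshold_large G (d := 21) (by decide +kernel) hreg hG hE⟩
    · exact ⟨14, maxLevel_one_lt_expCutCount_threshold_large G (d := 22) (by decide +kernel) hreg hG hE⟩
    · exact ⟨15, maxLevel_one_lt_expCutCount_threshold_large G (d := 23) (by decide +kernel) hreg hG hE⟩
    · exact ⟨15, maxLevel_one_lt_expCutCount_threshold_large G (d := 24) (by decide +kernel) hreg hG hE⟩
    · exact ⟨16, maxLevel_one_lt_expCutCount_threshold_large G (d := 25) (by decide +kernel) hreg hG hE⟩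
    · exact ⟨16, maxLevel_one_lt_expCutCount_threshold_large G (d := 26) (by decide +kernel) hreg hG hE⟩
    · exact ⟨17, maxLevel_one_lt_expCutCount_threshold_large G (d := 27) (by decide +kernel) hreg hG hE⟩
    · exact ⟨17, maxLevel_one_lt_expCutCount_threshold_large G (d := 28) (by decide +kernel) hreg hG hE⟩
    · exact ⟨18, maxLevel_one_lt_expCutCount_threshold_large G (d := 29) (by decide +kernel) hreg hG hE⟩
    · exact ⟨18, maxLevel_one_lt_expCutCount_threshold_large G (d := 30) (by decide +kernel) hreg hG hE⟩
    · exact ⟨19, maxLevel_one_lt_expCutCount_threshold_large G (d := 31) (by decide +kernel) hreg hG hE⟩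
    · exact ⟨20, maxLevel_one_lt_expCutCount_threshold_large G (d := 32) (by decide +kernel) hreg hG hE⟩
    · exact ⟨20, maxLevel_one_lt_expCutCount_threshold_large G (d := 33) (by decide +kernel) hreg hG hE⟩
    · exact ⟨21, maxLevel_one_lt_expCutCount_threshold_large G (d := 34) (by decide +kernel) hreg hG hE⟩
    · exact ⟨21, maxLevel_one_lt_expCutCount_threshold_large G (d := 35) (by decide +kernel) hreg hG hE⟩
    · exact ⟨22, maxLevel_one_lt_expCutCount_threshold_large G (d := 36) (by decide +kernel) hreg hG hE⟩
    · exact ⟨22, maxLevel_one_lt_expCutCount_threshold_large G (d := 37) (by decide +kernel) hreg hG hE⟩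
    · exact ⟨23, maxLevel_one_lt_expCutCount_threshold_large G (d := 38) (by decide +kernel) hreg hG hE⟩
    · exact ⟨23, maxLevel_one_lt_expCutCount_threshold_large G (d := 39) (by decide +kernel) hreg hG hE⟩
    · exact ⟨24, maxLevel_one_lt_expCutCount_threshold_large G (d := 40) (by decide +kernel) hreg hG hE⟩
    · exact ⟨24, maxLevel_one_lt_expCutCount_threshold_large G (d := 41) (by decide +kernel) hreg hG hE⟩
    · exact ⟨25, maxLevel_one_lt_expCutCount_threshold_large G (d := 42) (by decide +kernel) hreg hG hE⟩
    · exact ⟨25, maxLevel_one_lt_expCutCount_threshold_large G (d := 43) (by decide +kernel) hreg hG hE⟩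
    · exact ⟨26, maxLevel_one_lt_expCutCount_threshold_large G (d := 44) (by decide +kernel) hreg hG hE⟩
    · exact ⟨26, maxLevel_one_lt_expCutCount_threshold_large G (d := 45) (by decide +kernel) hreg hG hE⟩
    · exact ⟨27, maxLevel_one_lt_expCutCount_threshold_large G (d := 46) (by decide +kernel) hreg hG hE⟩
    · exact ⟨28, maxLevel_one_lt_expCutCount_threshold_large G (d := 47) (by decide +kernel) hreg hG hE⟩
    · exact ⟨28, maxLevel_one_lt_expCutCount_threshold_large G (d := 48) (by decide +kernel) hreg hG hE⟩
    · exact ⟨29, maxLevel_one_lt_expCutCount_threshold_large G (d := 49) (by decide +kernel) hreg hG hE⟩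
    · exact ⟨29, maxLevel_one_lt_expCutCount_threshold_large G (d := 50) (by decide +kernel) hreg hG hE⟩
    · exact ⟨30, maxLevel_one_lt_expCutCount_threshold_large G (d := 51) (by decide +kernel) hreg hG hE⟩
    · exact ⟨30, maxLevel_one_lt_expCutCount_threshold_large G (d := 52) (by decide +kernel) hreg hG hE⟩
    · exact ⟨31, maxLevel_one_lt_expCutCount_threshold_large G (d := 53) (by decide +kernel) hreg hG hE⟩
    · exact ⟨31, maxLevel_one_lt_expCutCount_threshold_large G (d := 54) (by decide +kernel) hreg hG hE⟩
    · exact ⟨32, maxLevel_one_lt_expCutCount_threshold_large G (d := 55) (by decide +kernel) hreg hG hE⟩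
    · exact ⟨32, maxLevel_one_lt_expCutCount_threshold_large G (d := 56) (by decide +kernel) hreg hG hE⟩
    · exact ⟨33, maxLevel_one_lt_expCutCount_threshold_large G (d := 57) (by decide +kernel) hreg hG hE⟩
    · exact ⟨33, maxLevel_one_lt_expCutCount_threshold_large G (d := 58) (by decide +kernel) hreg hG hE⟩
    · exact ⟨34, maxLevel_one_lt_expCutCount_threshold_large G (d := 59) (by decide +kernel) hreg hG hE⟩
    · exact ⟨34, maxLevel_one_lt_expCutCount_threshold_large G (d := 60) (by decide +kernel) hreg hG hE⟩
    · exact ⟨35, maxLevel_one_lt_expCutCount_threshold_large G (d := 61) (by decide +kernel) hreg hG hE⟩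
    · exact ⟨35, maxLevel_one_lt_expCutCount_threshold_large G (d := 62) (by decide +kernel) hreg hG hE⟩
    · exact ⟨36, maxLevel_one_lt_expCutCount_threshold_large G (d := 63) (by decide +kernel) hreg hG hE⟩
    · exact ⟨37, maxLevel_one_lt_expCutCount_threshold_large G (d := 64) (by decide +kernel) hreg hG hE⟩
    · exact ⟨37, maxLevel_one_lt_expCutCount_threshold_large G (d := 65) (by decide +kernel) hreg hG hE⟩
    · exact ⟨38, maxLevel_one_lt_expCutCount_threshold_large G (d := 66) (by decide +kernel) hreg hG hE⟩
    · exact ⟨38, maxLevel_one_lt_expCutCount_threshold_large G (d := 67) (by decide +kernel) hreg hG hE⟩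
    · exact ⟨39, maxLevel_one_lt_expCutCount_threshold_large G (d := 68) (by decide +kernel) hreg hG hE⟩
    · exact ⟨39, maxLevel_one_lt_expCutCount_threshold_large G (d := 69) (by decide +kernel) hreg hG hE⟩
    · exact ⟨40, maxLevel_one_lt_expCutCount_threshold_large G (d := 70) (by decide +kernel) hreg hG hE⟩
    · exact ⟨40, maxLevel_one_lt_expCutCount_threshold_large G (d := 71) (by decide +kernel) hreg hG hE⟩
    · exact ⟨41, maxLevel_one_lt_expCutCount_threshold_large G (d := 72) (by decide +kernel) hreg hG hE⟩
    · exact ⟨41, maxLevel_one_lt_expCutCount_threshold_large G (d := 73) (by decide +kernel) hreg hG hE⟩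
    · exact ⟨42, maxLevel_one_lt_expCutCount_threshold_large G (d := 74) (by decide +kernel) hreg hG hE⟩
    · exact ⟨42, maxLevel_one_lt_expCutCount_threshold_large G (d := 75) (by decide +kernel) hreg hG hE⟩
    · exact ⟨43, maxLevel_one_lt_expCutCount_threshold_large G (d := 76) (by decide +kernel) hreg hG hE⟩
    · exact ⟨43, maxLevel_one_lt_expCutCount_threshold_large G (d := 77) (by decide +kernel) hreg hG hE⟩
    · exact ⟨44, maxLevel_one_lt_expCutCount_threshold_large G (d := 78) (by decide +kernel) hreg hG hE⟩
    · exact ⟨44, maxLevel_one_lt_expCutCount_threshold_large G (d := 79) (by decide +kernel) hreg hG hE⟩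
    · exact ⟨45, maxLevel_one_lt_expCutCount_threshold_large G (d := 80) (by decide +kernel) hreg hG hE⟩
    · exact ⟨45, maxLevel_one_lt_expCutCount_threshold_large G (d := 81) (by decide +kernel) hreg hG hE⟩
    · exact ⟨46, maxLevel_one_lt_expCutCount_threshold_large G (d := 82) (by decide +kernel) hreg hG hE⟩
    · exact ⟨47, maxLevel_one_lt_expCutCount_threshold_large G (d := 83) (by decide +kernel) hreg hG hE⟩
    · exact ⟨47, maxLevel_one_lt_expCutCount_threshold_large G (d := 84) (by decide +kernel) hreg hG hE⟩
    · exact ⟨48, maxLevel_one_lt_expCutCount_threshold_large G (d := 85) (by decide +kernel) hreg hG hE⟩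
    · exact ⟨48, maxLevel_one_lt_expCutCount_threshold_large G (d := 86) (by decide +kernel) hreg hG hE⟩
    · exact ⟨49, maxLevel_one_lt_expCutCount_threshold_large G (d := 87) (by decide +kernel) hreg hG hE⟩
    · exact ⟨49, maxLevel_one_lt_expCutCount_threshold_large G (d := 88) (by decide +kernel) hreg hG hE⟩
    · exact ⟨50, maxLevel_one_lt_expCutCount_threshold_large G (d := 89) (by decide +kernel) hreg hG hE⟩
    · exact ⟨50, maxLevel_one_lt_expCutCount_threshold_large G (d := 90) (by decide +kernel) hreg hG hE⟩
    · exact ⟨51, maxLevel_one_lt_expCutCount_threshold_large G (d := 91) (by decide +kernel) hreg hG hE⟩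
    · exact ⟨51, maxLevel_one_lt_expCutCount_threshold_large G (d := 92) (by decide +kernel) hreg hG hE⟩
    · exact ⟨52, maxLevel_one_lt_expCutCount_threshold_large G (d := 93) (by decide +kernel) hreg hG hE⟩
    · exact ⟨52, maxLevel_one_lt_expCutCount_threshold_large G (d := 94) (by decide +kernel) hreg hG hE⟩
    · exact ⟨53, maxLevel_one_lt_expCutCount_threshold_large G (d := 95) (by decide +kernel) hreg hG hE⟩
    · exact ⟨53, maxLevel_one_lt_expCutCount_threshold_large G (d := 96) (by decide +kernel) hreg hG hE⟩
    · exact ⟨54, maxLevel_one_lt_expCutCount_threshold_large G (d := 97) (by decide +kernel) hreg hG hE⟩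
    · exact ⟨54, maxLevel_one_lt_expCutCount_threshold_large G (d := 98) (by decide +kernel) hreg hG hE⟩
    · exact ⟨55, maxLevel_one_lt_expCutCount_threshold_large G (d := 99) (by decide +kernel) hreg hG hE⟩

end QAOA

end Literature.Computability.QuantumComplexity
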